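import Literature.NumberTheory.Automorphic.Liu2021.Def411WeilCarriersFrameTransport
import Literature.NumberTheory.Automorphic.Liu2021.Def411WeilCarriersAtLineTransport
import HarnessLib

/-!
# [Liu2021, Def. 4.11]'s carriers `ω(μ, ε, χ)` at a line `⟨a⟩` do not depend on the rational frame of `V`

Topic `NumberTheory/Automorphic/Liu2021`; namespace `Literature.NumberTheory.Automorphic.Liu2021.Def411WeilCarriersDoubling` (PROOF sequel
of `Def411WeilCarriersFrameTransport` — the `FinSB`-level frame transport statement `chiSplittingFrameTransport` —
and of `Def411WeilCarriersAtLineTransport` — the coinvariant transport `exists_omegaAtLine_equiv_rhoVAtLine_of_finPairRep_conj`).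
ONE THEOREM; no definition, no named fact, no `sorry`.  Nothing of [Liu2021] is asserted.

WHY.  `omegaAtLine L⁺ L c̄ N e (diagonal dV) … (isCompatible_chiSplittingLine …) a χ_W` realises `ω(μ, ε, χ_W)` in ONE real diagonal
frame `dV` of the hermitian space; a consumer meeting the same space in a second frame `dV′` (the Hodge CM programme's GS-6 glue reads
`V` once in a rational frame chosen from `V` and once in a frame adapted to a face `V = V⋆ ⊕ V⊥`) needs the two carriers identified
`U(diag dV)(𝔸_f) ≃ U(diag dV′)(𝔸_f)`-equivariantly along the conjugation `finAdelicCongr B` by the rational isometry `B`.  The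
`FinSB`-level statement `chiSplittingFrameTransport` (`∃ Q` conjugating the two finite Weil representations of the pair at the χ-attached
splittings) is stated in `Def411WeilCarriersFrameTransport` and proved in `Def411WeilCarriersFrameTransportHolds`; this file descends it to the carriers, GIVEN the statement as a hypothesis
(the hypothesis-free corollary, over `Def411WeilCarriersFrameTransportHolds`, is the sequel `Def411WeilCarriersAtLineFrameTransportOfIsometry`).

## References
* [Liu2021] Y. Liu, *Fourier–Jacobi cycles and arithmetic relative trace formula*, Camb. J. Math. 9 (2021) = arXiv:2102.11518:
  Def. 4.11 (l. 2092–2096), App. D §D.1 Steps 2–3 (l. 5217–5221).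
* [GelbartRogawski1991] S. Gelbart, J. Rogawski, Invent. Math. 105 (1991), §3.1 Prop. 3.1.1 p. 455, Remark p. 457 L4–13.
* [PlatonovRapinchuk1994] V. Platonov, A. Rapinchuk, *Algebraic groups and number theory*, Academic Press (1994), §2.3.
-/

noncomputable section

open scoped Matrix
open NumberField
open Literature.NumberTheory.Automorphic Literature.NumberTheory.Automorphic.UnitaryGroup
open Literature.NumberTheory.GelbartRogawski1991 Literature.NumberTheory.GelbartRogawski1991.UnitaryDualPair
open Literature.NumberTheory.GelbartRogawski1991.UnitaryDualPair.WeilCoinv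
open Literature.NumberTheory.GelbartRogawski1991.GRConstruction
open Literature.RepresentationTheory.HarrisKudlaSweet1996
open Literature.NumberTheory.GaloisRepresentations

/-! ## The descent of `chiSplittingFrameTransport` to the carriers `ω(μ,ε,χ)` -/

namespace Literature.NumberTheory.Automorphic.Liu2021.Def411WeilCarriersDoubling

open Literature.NumberTheory.GelbartRogawski1991.GRConstruction
open Literature.NumberTheory.GaloisRepresentations
open Literature.NumberTheory.Automorphic.Liu2021.Def411WeilCarriers

/-- **`chiSplittingFrameTransport → ∃ Ψ`**: under the `FinSB`-level frame transport `chiSplittingFrameTransport`, for every CM field `L`, real diagonal frames `dV`, `dV′`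
related by a rational ISOMETRY `B` (`ᵗ(c̄B)·(diag dV′)·B = diag dV`), unitary splitting character `χ`, line `⟨a⟩` and
`χ_W ∈ Chi`, the carriers `ω(μ,ε,χ_W)` at the χ-attached splitting families over `diag dV` and over `diag dV′` are isomorphic
`U(diag dV)(𝔸_f) ≃ U(diag dV′)(𝔸_f)`-equivariantly along `finAdelicCongr B`. [cite: Liu2021, Def. 4.11 (l. 2092–2096)]
[cite: GelbartRogawski1991, §3.1 Remark p. 457 L4–13] -/
theorem exists_omegaAtLine_equiv_of_chiSplittingFrameTransport (hT : chiSplittingFrameTransport)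
    (L : Type) [Field L] [NumberField L] [IsCMField L] {N n : ℕ} (e : Fin N × Fin 1 ≃ Fin n)
    (dV : Fin N → L) (hdV : ∀ i, IsCMField.complexConj L (dV i) = dV i) (hdV0 : ∀ i, dV i ≠ 0)
    (dV' : Fin N → L) (hdV' : ∀ i, IsCMField.complexConj L (dV' i) = dV' i) (hdV'0 : ∀ i, dV' i ≠ 0)
    (B : GL (Fin N) L)
    (hB : formCongr ((IsCMField.complexConj L : L ≃ₐ[Fp L] L) : L →+* L) B ((1 : L) • Matrix.diagonal dV') =
      Matrix.diagonal dV)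
    (χ : HeckeCharacter L) (hχu : χ.IsUnitary) (hχs : IsSplittingChar L 1 χ)
    (a : (Fp L)ˣ) (χW : Chi (Fp L) L (IsCMField.complexConj L)) :
    ∃ Ψ : omegaAtLine (Fp L) L (IsCMField.complexConj L) N e (Matrix.diagonal dV) (complexConj_imagUnit L)
          (imagUnit_ne_zero L) (imagUnit_mul_self L) (realDiagonal_isSymm L dV hdV) (isUnit_det_realDiagonal L dV hdV hdV0)
          (realDiagonal_map L dV hdV).symm
          (fun a' => isCompatible_chiSplittingLine L e dV hdV hdV0 χ hχu hχs (TW (Fp L) a') (isSymm_TW (Fp L) a')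
            (isUnit_det_TW (Fp L) a') (JW (Fp L) L a') (JW_eq (Fp L) L a')) a χW ≃ₗ[ℂ]
        omegaAtLine (Fp L) L (IsCMField.complexConj L) N e (Matrix.diagonal dV') (complexConj_imagUnit L)
          (imagUnit_ne_zero L) (imagUnit_mul_self L) (realDiagonal_isSymm L dV' hdV') (isUnit_det_realDiagonal L dV' hdV' hdV'0)
          (realDiagonal_map L dV' hdV').symm
          (fun a' => isCompatible_chiSplittingLine L e dV' hdV' hdV'0 χ hχu hχs (TW (Fp L) a') (isSymm_TW (Fp L) a')
            (isUnit_det_TW (Fp L) a') (JW (Fp L) L a') (JW_eq (Fp L) L a')) a χW,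
      ∀ (k : UnitaryGroup.finAdelic (Fp L) L (IsCMField.complexConj L) N (Matrix.diagonal dV))
        (x : omegaAtLine (Fp L) L (IsCMField.complexConj L) N e (Matrix.diagonal dV) (complexConj_imagUnit L)
          (imagUnit_ne_zero L) (imagUnit_mul_self L) (realDiagonal_isSymm L dV hdV) (isUnit_det_realDiagonal L dV hdV hdV0)
          (realDiagonal_map L dV hdV).symm
          (fun a' => isCompatible_chiSplittingLine L e dV hdV hdV0 χ hχu hχs (TW (Fp L) a') (isSymm_TW (Fp L) a')
            (isUnit_det_TW (Fp L) a') (JW (Fp L) L a') (JW_eq (Fp L) L a')) a χW),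
        Ψ (rhoVAtLine (Fp L) L (IsCMField.complexConj L) N e (Matrix.diagonal dV) (complexConj_imagUnit L)
              (imagUnit_ne_zero L) (imagUnit_mul_self L) (realDiagonal_isSymm L dV hdV) (isUnit_det_realDiagonal L dV hdV hdV0)
              (realDiagonal_map L dV hdV).symm
              (fun a' => isCompatible_chiSplittingLine L e dV hdV hdV0 χ hχu hχs (TW (Fp L) a') (isSymm_TW (Fp L) a')
                (isUnit_det_TW (Fp L) a') (JW (Fp L) L a') (JW_eq (Fp L) L a')) a χW k x) =
          rhoVAtLine (Fp L) L (IsCMField.complexConj L) N e (Matrix.diagonal dV') (complexConj_imagUnit L)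
              (imagUnit_ne_zero L) (imagUnit_mul_self L) (realDiagonal_isSymm L dV' hdV') (isUnit_det_realDiagonal L dV' hdV' hdV'0)
              (realDiagonal_map L dV' hdV').symm
              (fun a' => isCompatible_chiSplittingLine L e dV' hdV' hdV'0 χ hχu hχs (TW (Fp L) a') (isSymm_TW (Fp L) a')
                (isUnit_det_TW (Fp L) a') (JW (Fp L) L a') (JW_eq (Fp L) L a')) a χW
            (finAdelicCongr (Fp L) L (IsCMField.complexConj L) B one_ne_zero hB k) (Ψ x) := by
  obtain ⟨Q, hQ⟩ := hT L e dV hdV hdV0 dV' hdV' hdV'0 B hB χ hχu hχs (TW (Fp L) a) (isSymm_TW (Fp L) a)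
    (isUnit_det_TW (Fp L) a) (JW (Fp L) L a) (JW_eq (Fp L) L a)
  exact exists_omegaAtLine_equiv_rhoVAtLine_of_finPairRep_conj (Fp L) L (IsCMField.complexConj L) N e
    (Matrix.diagonal dV) (Matrix.diagonal dV') (complexConj_imagUnit L) (imagUnit_ne_zero L) (imagUnit_mul_self L)
    (realDiagonal_isSymm L dV hdV) (realDiagonal_isSymm L dV' hdV') (isUnit_det_realDiagonal L dV hdV hdV0)
    (isUnit_det_realDiagonal L dV' hdV' hdV'0) (realDiagonal_map L dV hdV).symm (realDiagonal_map L dV' hdV').symm _ _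
    a χW B one_ne_zero hB Q hQ


end Literature.NumberTheory.Automorphic.Liu2021.Def411WeilCarriersDoubling

end
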